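import Literature.AlgebraicGeometry.Resolution.EffectiveResolutionSpread
import Literature.AlgebraicGeometry.Resolution.EffectiveResolutionMarked
import Literature.AlgebraicGeometry.Resolution.BlowupsComposition
import Literature.AlgebraicGeometry.Resolution.AffineBlowupUniversal
import Literature.AlgebraicGeometry.Resolution.IdealSheafLemmas
import Mathlib.AlgebraicGeometry.FunctionField
import Mathlib.RingTheory.Spectrum.Prime.RingHom
import HarnessLib

/-!
# The resolution datum over a field of characteristic zero: one blow-up of `𝔸ⁿ` and a regular
# closure

Topic: `Literature/AlgebraicGeometry/Resolution`. Input of the spreading-out proof of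
`BierstoneGrigorievMilmanWlodarczyk2011` (`EffectiveResolution.lean`; BGMW 2011, Cor. 8.0.6 in
the weak non-embedded form) from resolution of marked ideals in characteristic zero
(`CharZeroMarkedResolution`, `EffectiveResolutionSpread.lean`, a theorem of Kollár's Thm. 3.69).
What the spreading argument transports from the generic fibre is not the marked resolution
(centres, boundaries, normal crossings at every stage) but a single, model-independent datum:

**Theorem** (`exists_blowup_regular_closure`). Let `K` be a field, `S ⊆ K[x₁, …, xₙ]` finite with
`I = (S)` prime, and suppose the marked ideal `(𝔸ⁿ_K, 𝓘_{V(S)}, ∅, 1)` has a resolution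
(`HasMarkedResolution K n S`). Then there are an ideal `Q ⊆ K[x]` and `t ∈ Q ∖ I` such that for
EVERY blow-up `p : P → 𝔸ⁿ_K` of `𝔸ⁿ_K` along `Q`, the reduced closed subscheme of `P` on
`closure (p⁻¹(V(I) ∩ D(t)))` is a regular scheme.

Proof (BGMW 2011 §3.3 (1) ⇒ (3) ⇒ (4), Kollár 2007 proof of Cor. 3.22, as already formalized in
`EffectiveResolutionMarked.lean`): along the resolution, the first centre through the point over
the generic point `ξ` of `V(I)` makes the strict transform of `V(I)` regular
(`IsMultipleBlowup.isEmbeddedTransform_or_isRegular`); the blow-ups before it have centres over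
`{ξ}ᶜ`, so their composite `σ'` is ONE blow-up along an ideal sheaf `Q` with `ξ ∉ V(Q)`
(Stacks 080B, `IsBlowup.exists_isBlowup_comp_supported`, iterated:
`IsEmbeddedTransform.exists_isBlowup`); pick `t ∈ Q ∖ I`; `σ'` is an isomorphism over `D(t)`, so
the strict transform is `closure (σ'⁻¹(V(I) ∩ D(t)))`; finally blow-ups are unique up to unique
isomorphism and reduced closed subschemes are determined by their support, which makes the
statement independent of the model `(P, p)`.

* `affineBlowup.exists_eq_idealSheaf`, `ker_specMap_quotient_mk`, `affineZeroLocusι_ker_eq` —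
  bookkeeping between ideals of `R` and ideal sheaves on `Spec R` (`affineBlowup.idealSheaf`,
  `AffineBlowupCartier.lean`, `affineBlowup.support_idealSheaf` of `AffineBlowupUnique.lean`);
* `IsEmbeddedTransform.exists_isBlowup` — a sequence of blow-ups with centres over `T` on a
  Noetherian scheme is a single blow-up along an ideal sheaf supported in `T`;
* `isRegular_vanishingIdeal_of_iso` — transport of "the reduced closed subscheme on `Z` is
  regular" along isomorphisms;
* `exists_blowup_regular_closure` — the theorem.

## Sources

* E. Bierstone, D. Grigoriev, P. Milman, J. Włodarczyk, arXiv:1206.3090, §3.3 (1)⇒(4)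
  (numbering as in `EffectiveResolution.lean`). [BierstoneGrigorievMilmanWlodarczyk2011]
* J. Kollár, *Lectures on Resolution of Singularities* (2007), proof of Cor. 3.22. [Kollar2007]
* The Stacks Project, Tag 080B (composition of blow-ups). [StacksProject]
-/

noncomputable section

universe u

open CategoryTheory CategoryTheory.Limits AlgebraicGeometry TopologicalSpace

namespace Literature.AlgebraicGeometry.Resolution

open Scheme.IdealSheafData

/-! ## Ideals of `R` and ideal sheaves on `Spec R` -/

section AffineIdealSheaf

variable {R : Type u} [CommRing R]

/-- The top ideal of the ideal sheaf of `I ⊆ R`. [folklore] -/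
theorem affineBlowup.idealSheaf_ideal_top (I : Ideal R) :
    (affineBlowup.idealSheaf I).ideal ⟨⊤, isAffineOpen_top _⟩ =
      I.map (Scheme.ΓSpecIso (.of R)).inv.hom :=
  ideal_ofIdealTop_top _

/-- Every ideal sheaf on `Spec R` is the ideal sheaf of an ideal of `R`. [folklore] -/
theorem affineBlowup.exists_eq_idealSheaf (J : (Spec (CommRingCat.of R)).IdealSheafData) :
    ∃ I : Ideal R, J = affineBlowup.idealSheaf I := by
  refine ⟨(J.ideal ⟨⊤, isAffineOpen_top _⟩).comap (Scheme.ΓSpecIso (.of R)).inv.hom, ?_⟩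
  have hsurj : Function.Surjective (Scheme.ΓSpecIso (.of R)).inv.hom :=
    (Scheme.ΓSpecIso (.of R)).commRingCatIsoToRingEquiv.symm.surjective
  unfold affineBlowup.idealSheaf
  rw [Ideal.map_comap_of_surjective _ hsurj]
  exact (equivOfIsAffine.symm_apply_apply J).symm

/-- The ideal sheaf of `I` pulls back along `Spec B → Spec A` to the ideal sheaf of `I B`.
[folklore] -/
theorem affineBlowup.comap_idealSheaf_specMap {A B : Type u} [CommRing A] [CommRing B]
    (φ : A →+* B) (I : Ideal A) :
    (affineBlowup.idealSheaf I).comap (Spec.map (CommRingCat.ofHom φ)) =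
      affineBlowup.idealSheaf (I.map φ) :=
  comap_ofIdealTop_SpecMap φ I

/-- **The kernel of `Spec (R ⧸ I) → Spec R` is the ideal sheaf of `I`.** [folklore] -/
theorem ker_specMap_quotient_mk (I : Ideal R) :
    (Spec.map (CommRingCat.ofHom (Ideal.Quotient.mk I))).ker = affineBlowup.idealSheaf I := by
  rw [Scheme.ker_of_isAffine]
  unfold affineBlowup.idealSheaf
  congr 1
  -- `ker (Spec φ)^* = e (ker φ)` for the isomorphism `e = ΓSpecIso⁻¹`
  have hnat := Scheme.ΓSpecIso_inv_naturality (CommRingCat.ofHom (Ideal.Quotient.mk I))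
  -- `(Spec.map f).appTop = ΓSpecIso.hom ≫ f ≫ ΓSpecIso.inv`
  have happ : (Spec.map (CommRingCat.ofHom (Ideal.Quotient.mk I))).appTop =
      (Scheme.ΓSpecIso (.of R)).hom ≫ (CommRingCat.ofHom (Ideal.Quotient.mk I) ≫
        (Scheme.ΓSpecIso (.of (R ⧸ I))).inv) :=
    (Iso.inv_comp_eq _).mp hnat.symm
  rw [happ]
  ext f
  simp only [RingHom.mem_ker, CommRingCat.hom_comp, RingHom.coe_comp, Function.comp_apply]
  have hinj : Function.Injective (Scheme.ΓSpecIso (.of (R ⧸ I))).inv.hom :=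
    (Scheme.ΓSpecIso (.of (R ⧸ I))).commRingCatIsoToRingEquiv.symm.injective
  have hsurj : Function.Surjective (Scheme.ΓSpecIso (.of R)).inv.hom :=
    (Scheme.ΓSpecIso (.of R)).commRingCatIsoToRingEquiv.symm.surjective
  rw [← map_zero (Scheme.ΓSpecIso (.of (R ⧸ I))).inv.hom, hinj.eq_iff,
    CommRingCat.hom_ofHom, Ideal.Quotient.eq_zero_iff_mem, Ideal.mem_map_iff_of_surjective _ hsurj]
  constructor
  · intro h
    exact ⟨_, h, by rw [← CommRingCat.comp_apply, Iso.hom_inv_id]; rfl⟩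
  · rintro ⟨g, hg, rfl⟩
    rwa [← CommRingCat.comp_apply, Iso.inv_hom_id, CommRingCat.id_apply]

/-- The ideal sheaf `𝓘_{V(S)}` of `V(S) ↪ 𝔸ⁿ_k` is the ideal sheaf of `(S)`. [folklore] -/
theorem affineZeroLocusι_ker_eq (k : Type) [Field k] (n : ℕ)
    (S : Finset (MvPolynomial (Fin n) k)) :
    (affineZeroLocusι k n S).ker =
      affineBlowup.idealSheaf (Ideal.span (S : Set (MvPolynomial (Fin n) k))) :=
  ker_specMap_quotient_mk _

end AffineIdealSheaf

/-! ## A sequence of blow-ups with centres over `T` is one blow-up supported in `T` -/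

/-- **A sequence of blow-ups with centres over `T` is a single blow-up along an ideal sheaf
supported in `T`** (Noetherian base; Stacks 080B iterated,
`IsBlowup.exists_isBlowup_comp_supported`). [cite: StacksProject, Tag 080B] -/
theorem IsEmbeddedTransform.exists_isBlowup {X : Scheme.{u}} [IsNoetherian X] {Y T : Set X}
    {X' : Scheme.{u}} {σ : X' ⟶ X} {Y' : Set X'} (h : IsEmbeddedTransform Y T σ Y') :
    ∃ Q : X.IdealSheafData, IsBlowup σ Q ∧ (Q.support : Set X) ⊆ T := by
  induction h with
  | refl => exact ⟨⊤, isBlowup_id_top X, by simp⟩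
  | @blowup X' X'' σ Y' h C τ hτ hC hT ih =>
    obtain ⟨Q, hQ, hQT⟩ := ih
    exact IsBlowup.exists_isBlowup_comp_supported σ Q τ C T hQ hQT hτ
      (fun x hx => hT ⟨x, hx, rfl⟩)

/-! ## Transport of reduced closed subschemes along isomorphisms -/

/-- **Reduced closed subschemes are determined by their support, functorially in isomorphisms**:
if `e : X ≅ X'` maps the closed set `Z` onto `Z'` and the reduced closed subscheme of `X` on `Z` is
regular, so is the reduced closed subscheme of `X'` on `Z'`. [folklore] -/
theorem isRegular_vanishingIdeal_of_iso {X X' : Scheme.{u}} (e : X ≅ X') (Z : Closeds X)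
    (Z' : Closeds X') (hZ : e.hom '' (Z : Set X) = Z')
    (hreg : Scheme.IsRegular (vanishingIdeal Z).subscheme) :
    Scheme.IsRegular (vanishingIdeal Z').subscheme := by
  haveI : IsReduced (vanishingIdeal Z).subscheme := isReduced_subscheme_vanishingIdeal Z
  let j : (vanishingIdeal Z).subscheme ⟶ X' := (vanishingIdeal Z).subschemeι ≫ e.hom
  have hrange : Set.range j = (Z' : Set X') := by
    change Set.range ((vanishingIdeal Z).subschemeι ≫ e.hom) = _
    rw [Scheme.Hom.comp_base, TopCat.coe_comp, Set.range_comp, range_subschemeι,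
      coe_support_vanishingIdeal, hZ]
  have hker : (vanishingIdeal Z').subschemeι.ker = j.ker := by
    rw [ker_subschemeι, ker_eq_vanishingIdeal_of_isReduced]
    congr 1
    ext x
    change x ∈ (Z' : Set X') ↔ x ∈ closure (Set.range j)
    rw [hrange, Z'.isClosed.closure_eq]
  haveI := IsClosedImmersion.isIso_lift _ j hker
  exact hreg.of_iso (IsClosedImmersion.lift _ j hker.le)

/-! ## The datum -/

/-- **The char-0 resolution datum.** Let `K` be a field, `S ⊆ K[x₁, …, xₙ]` finite generating a
PRIME ideal `I`, and assume the marked ideal `(𝔸ⁿ_K, 𝓘_{V(S)}, ∅, 1)` has a resolution. Then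
there are an ideal `Q ⊆ K[x]` and `t ∈ Q`, `t ∉ I`, such that for every blow-up
`p : P → 𝔸ⁿ_K` along `Q` the reduced closed subscheme of `P` on `closure (p⁻¹(V(I) ∩ D(t)))`
is regular (BGMW 2011 §3.3 (1) ⇒ (3): the strict transform of `V(I)` at the stage where a
centre first passes through the point over its generic point; the earlier blow-ups compose to one
blow-up along `Q` by Stacks 080B). [cite: BierstoneGrigorievMilmanWlodarczyk2011, §3.3 (1)⇒(4), p. 7] -/
theorem exists_blowup_regular_closure {K : Type} [Field K] {n : ℕ}
    (S : Finset (MvPolynomial (Fin n) K))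
    (hprime : (Ideal.span (S : Set (MvPolynomial (Fin n) K))).IsPrime)
    (h : HasMarkedResolution K n S) :
    ∃ (Q : Ideal (MvPolynomial (Fin n) K)) (t : MvPolynomial (Fin n) K),
      t ∈ Q ∧ t ∉ Ideal.span (S : Set (MvPolynomial (Fin n) K)) ∧
      ∀ (P : Scheme.{0}) (p : P ⟶ Spec (CommRingCat.of (MvPolynomial (Fin n) K))),
        IsBlowup p (affineBlowup.idealSheaf Q) →
        Scheme.IsRegular (vanishingIdeal (⟨closure (p ⁻¹'
          (PrimeSpectrum.zeroLocus (Ideal.span (S : Set (MvPolynomial (Fin n) K)) :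
              Set (MvPolynomial (Fin n) K)) ∩
            ((PrimeSpectrum.basicOpen t : Opens (PrimeSpectrum (MvPolynomial (Fin n) K))) :
              Set (PrimeSpectrum (MvPolynomial (Fin n) K))))), isClosed_closure⟩ :
                Closeds P)).subscheme := by
  classical
  set I : Ideal (MvPolynomial (Fin n) K) := Ideal.span (S : Set (MvPolynomial (Fin n) K)) with hI
  haveI := hprime
  haveI : IsDomain (MvPolynomial (Fin n) K ⧸ I) := Ideal.Quotient.isDomain I
  -- the closed immersion `ι : Y = V(S) ↪ 𝔸ⁿ` and the generic point `ξ` of its image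
  let X := Spec (CommRingCat.of (MvPolynomial (Fin n) K))
  let Y := affineZeroLocus K n S
  let ι : Y ⟶ X := affineZeroLocusι K n S
  haveI : IsIntegral Y := by
    change IsIntegral (Spec (CommRingCat.of (MvPolynomial (Fin n) K ⧸ I)))
    infer_instance
  set ξ : X := ι (genericPoint Y) with hξdef
  have hξI : ξ.asIdeal = I := by
    have hg : genericPoint Y = (⊥ : PrimeSpectrum (MvPolynomial (Fin n) K ⧸ I)) :=
      genericPoint_eq_bot_of_affine (CommRingCat.of (MvPolynomial (Fin n) K ⧸ I))
    rw [hξdef, hg]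
    change Ideal.comap (Ideal.Quotient.mk I) ⊥ = I
    rw [← RingHom.ker_eq_comap_bot, Ideal.mk_ker]
  have hgen : IsGenericPoint ξ (Set.range ι) := by
    have := (genericPoint_spec Y).image ι.continuous
    rwa [Set.image_univ, ι.isClosedEmbedding.isClosed_range.closure_eq] at this
  have hYξ : Set.range ι = closure {ξ} := hgen.symm
  have hrangeV : Set.range ι = PrimeSpectrum.zeroLocus (I : Set (MvPolynomial (Fin n) K)) := by
    have e1 : Set.range ι = Set.range (PrimeSpectrum.comap (Ideal.Quotient.mk I)) := rfl
    rw [e1, range_comap_of_surjective _ _ Ideal.Quotient.mk_surjective, Ideal.mk_ker]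
  obtain ⟨X', σ, M', hres⟩ := h
  have hsupp : ((ι.ker).support : Set X) = Set.range ι := by
    rw [Scheme.Hom.support_ker, ι.isClosedEmbedding.isClosed_range.closure_eq]
  have hξ : ξ ∈ (ι.ker).support := by
    rw [← SetLike.mem_coe, hsupp]
    exact Set.mem_range_self _
  have hV : ((ι.ker).support : Set X) ⊆ closure {ξ} := by rw [hsupp, hYξ]
  have hξT : ξ ∉ ({ξ}ᶜ : Set X) := by simp
  rcases hres.1.isEmbeddedTransform_or_isRegular rfl hξ hV with
    ⟨X'', σ', Y', hET, hreg⟩ | ⟨Y', ξ', -, -, hξ'V, -, hμ'⟩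
  swap
  · exfalso
    have hempty : M'.support = ∅ := hres.2
    rw [M'.support_of_mult_eq_one hμ'] at hempty
    have : ξ' ∈ (M'.ideal.support : Set X') := hξ'V
    rw [hempty] at this
    exact this
  -- the sequence `σ'` is one blow-up along some `Q` with `ξ ∉ V(Q)`
  obtain ⟨hσ', V, hTV, hiso, ξ', hξ', hY'⟩ := hET.isProper_and_exists stacks02NS_holds hξT
  obtain ⟨Qsh, hbl, hQT⟩ := hET.exists_isBlowup
  obtain ⟨Q, rfl⟩ := affineBlowup.exists_eq_idealSheaf Qsh
  have hξQ : ξ ∉ PrimeSpectrum.zeroLocus (Q : Set (MvPolynomial (Fin n) K)) := by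
    rw [← affineBlowup.support_idealSheaf]
    exact fun h => hQT h rfl
  change ¬ ((Q : Set (MvPolynomial (Fin n) K)) ⊆ ξ.asIdeal) at hξQ
  rw [Set.not_subset] at hξQ
  obtain ⟨t, htQ, htξ⟩ := hξQ
  have htI : t ∉ I := by rwa [← hξI]
  refine ⟨Q, t, htQ, htI, fun P p hp => ?_⟩
  -- notation for the locally closed set `W = V(I) ∩ D(t)` and its preimages
  set W : Set X := PrimeSpectrum.zeroLocus (I : Set (MvPolynomial (Fin n) K)) ∩
    ((PrimeSpectrum.basicOpen t : Opens (PrimeSpectrum (MvPolynomial (Fin n) K))) :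
      Set (PrimeSpectrum (MvPolynomial (Fin n) K))) with hW
  -- `σ'` is an isomorphism over `D(t)`, which misses `V(Q)`
  let Dt : X.Opens := PrimeSpectrum.basicOpen t
  have hdisj : Disjoint (Dt : Set X) (affineBlowup.idealSheaf Q).support := by
    rw [affineBlowup.support_idealSheaf]
    refine Set.disjoint_left.mpr fun x hx hxQ => ?_
    exact (PrimeSpectrum.mem_basicOpen _ _).mp hx (hxQ htQ)
  have hisoD : IsIso (σ' ∣_ Dt) := hbl.isIso_morphismRestrict hdisj
  have hξD : ξ ∈ Dt := (PrimeSpectrum.mem_basicOpen _ _).mpr htξ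
  -- the strict transform `Y' = closure {ξ'}` is `closure (σ'⁻¹ W)`
  have hξW : ξ ∈ W := ⟨show (I : Set (MvPolynomial (Fin n) K)) ⊆ ξ.asIdeal by rw [hξI], hξD⟩
  have hfib : ∀ x : X'', σ' x = ξ → x = ξ' := by
    obtain ⟨x₀, -, huniq⟩ := existsUnique_preimage_of_isIso_morphismRestrict σ' hisoD hξD
    intro x hx
    exact (huniq x hx).trans (huniq ξ' hξ').symm
  have hclW : closure (σ' ⁻¹' W) = closure {ξ'} := by
    apply le_antisymm
    · refine closure_minimal ?_ isClosed_closure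
      intro x hx
      have hx1 : x ∈ σ' ⁻¹' closure {ξ} ∩ (σ' ⁻¹ᵁ Dt : Set X'') := by
        refine ⟨?_, hx.2⟩
        change σ' x ∈ closure {ξ}
        rw [← hYξ, hrangeV]
        exact hx.1
      have hx2 := preimage_closure_inter_subset_of_isIso_morphismRestrict σ' hisoD {ξ} hx1
      have hpre : σ' ⁻¹' {ξ} = {ξ'} := by
        ext z
        simp only [Set.mem_preimage, Set.mem_singleton_iff]
        exact ⟨fun hz => hfib z hz, fun hz => hz ▸ hξ'⟩
      rwa [hpre] at hx2
    · refine closure_mono (Set.singleton_subset_iff.mpr ?_)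
      change σ' ξ' ∈ W
      rwa [hξ']
  have hreg' : Scheme.IsRegular (vanishingIdeal
      (⟨closure (σ' ⁻¹' W), isClosed_closure⟩ : Closeds X'')).subscheme := by
    have e : (⟨closure (σ' ⁻¹' W), isClosed_closure⟩ : Closeds X'') =
        ⟨closure Y', isClosed_closure⟩ := by
      ext1
      change closure (σ' ⁻¹' W) = closure Y'
      rw [hclW, hY', closure_closure]
    rw [e]
    exact hreg
  -- transport to the model `(P, p)` through the unique isomorphism of blow-ups
  obtain ⟨e, he, he'⟩ := hbl.unique hp
  refine isRegular_vanishingIdeal_of_iso e _ _ ?_ hreg'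
  change e.hom '' closure (σ' ⁻¹' W) = closure (p ⁻¹' W)
  have hpre : p ⁻¹' W = e.hom '' (σ' ⁻¹' W) := by
    rw [← he', Scheme.Hom.comp_base, TopCat.coe_comp, Set.preimage_comp,
      Set.image_eq_preimage_of_inverse]
    · intro x
      exact congrArg (fun f => f.base x) e.hom_inv_id |>.trans rfl
    · intro x
      exact congrArg (fun f => f.base x) e.inv_hom_id |>.trans rfl
  rw [hpre]
  exact (Scheme.homeoOfIso e).image_closure (σ' ⁻¹' W)

end Literature.AlgebraicGeometry.Resolution

end
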